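import Literature.Analysis.FluidPDE.HardSphereCollisionRecord
import Literature.Analysis.FluidPDE.HardSphereTorusMeasure
import Literature.MathematicalPhysics.KineticTheory.HardSphereEuler
import Literature.MathematicalPhysics.KineticTheory.HardSphereEulerProofs
import Literature.MathematicalPhysics.KineticTheory.HardSphereTwoTimePressure
import HarnessLib

/-!
# Census assembly of the line `pedigree-perpetuity` — null events and the level count
# (crux `EnergyCurrentTails`, stmt-AtomisticToContinuum-9235)

Support file (`--supports stmt-AtomisticToContinuum-9235`) of the registered stub `stub_censusAssembly`
(lead c3 worker).  Measure-theoretic bookkeeping of the expected level census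
`E_P #{l : x ≤ ‖v_l(s)‖²} = ∫⁻ Σ_l 𝟙{x ≤ ‖(Φ_s z)_l.2‖²} dP` under a law `P` on phase space:

* it is the sum of the probabilities of the (measurable) level events (`lintegral_levelCount_eq_sum`),
  hence at most `N + 1` under a probability law (`lintegral_levelCount_le_card`);
* at `s = 0` (where `Φ_0 = id` on the good set) it is bounded by Markov through the tail energy of the
  data (`lintegral_levelCount_zero_le`);
* under a law `P ≪` Liouville, "particle `i` is in contact at time `s`" is a null event
  (`measure_participates_flow_eq_zero`: contact sets are Liouville-null, `volume_contactSet`, and the flow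
  preserves the Liouville measure);
* the abstract union bound turning a per-particle cover of the level event by four priced events (off the
  two null events) into a bound on the census (`sum_measure_le_of_cover`, the file's main theorem).

No lineage objects appear here (the file does not import the line's vocabulary).
-/

noncomputable section

open MeasureTheory Set
open scoped ENNReal BigOperators

namespace Summit.AtomisticToContinuum.HydrodynamicLimit.Theorems.EnergyCurrentTailsPedigree

open Literature.MathematicalPhysics.KineticTheory Literature.Analysis.FluidPDE

variable {N : ℕ} {ε : ℝ}

/-- The level event `{x ≤ ‖(Φ_s z)_l.2‖²}` is measurable. -/
theorem measurableSet_levelEvent (Φ : HardSphereFlow (Torus.geometry (Fin 3)) ε N) (s x : ℝ)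
    (l : Fin N) : MeasurableSet {z : Config N (Fin 3) T3 | x ≤ ‖(Φ.flow s z l).2‖ ^ 2} :=
  measurableSet_le measurable_const
    ((measurable_snd.comp ((measurable_pi_apply l).comp (Φ.measurable_flow s))).norm.pow_const 2)

/-- **The expected level count is the sum of the level probabilities**:
`∫⁻ Σ_l 𝟙{x ≤ ‖(Φ_s z)_l.2‖²} dP = Σ_l P{x ≤ ‖(Φ_s z)_l.2‖²}`. -/
theorem lintegral_levelCount_eq_sum (Φ : HardSphereFlow (Torus.geometry (Fin 3)) ε N)
    (P : Measure (Config N (Fin 3) T3)) (s x : ℝ) :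
    ∫⁻ z, (∑ l : Fin N, Set.indicator {v : V3 | x ≤ ‖v‖ ^ 2} (fun _ => (1 : ℝ≥0∞))
        ((Φ.flow s z l).2)) ∂P
      = ∑ l : Fin N, P {z | x ≤ ‖(Φ.flow s z l).2‖ ^ 2} := by
  have hind : ∀ (l : Fin N) (z : Config N (Fin 3) T3),
      Set.indicator {v : V3 | x ≤ ‖v‖ ^ 2} (fun _ => (1 : ℝ≥0∞)) ((Φ.flow s z l).2)
        = Set.indicator {z : Config N (Fin 3) T3 | x ≤ ‖(Φ.flow s z l).2‖ ^ 2} 1 z := by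
    intro l z
    by_cases h : x ≤ ‖(Φ.flow s z l).2‖ ^ 2
    · rw [Set.indicator_of_mem (show (Φ.flow s z l).2 ∈ {v : V3 | x ≤ ‖v‖ ^ 2} from h),
        Set.indicator_of_mem (show z ∈ {z : Config N (Fin 3) T3 | x ≤ ‖(Φ.flow s z l).2‖ ^ 2} from h)]
      rfl
    · rw [Set.indicator_of_notMem (show (Φ.flow s z l).2 ∉ {v : V3 | x ≤ ‖v‖ ^ 2} from h),
        Set.indicator_of_notMem
          (show z ∉ {z : Config N (Fin 3) T3 | x ≤ ‖(Φ.flow s z l).2‖ ^ 2} from h)]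
  simp_rw [hind]
  rw [lintegral_finsetSum _ fun l _ => measurable_one.indicator (measurableSet_levelEvent Φ s x l)]
  exact Finset.sum_congr rfl fun l _ => lintegral_indicator_one (measurableSet_levelEvent Φ s x l)

/-- Under a probability law the expected level count is at most the number of particles. -/
theorem lintegral_levelCount_le_card (Φ : HardSphereFlow (Torus.geometry (Fin 3)) ε N)
    (P : Measure (Config N (Fin 3) T3)) [IsProbabilityMeasure P] (s x : ℝ) :
    ∫⁻ z, (∑ l : Fin N, Set.indicator {v : V3 | x ≤ ‖v‖ ^ 2} (fun _ => (1 : ℝ≥0∞))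
        ((Φ.flow s z l).2)) ∂P ≤ (N : ℝ≥0∞) := by
  rw [lintegral_levelCount_eq_sum]
  calc ∑ l : Fin N, P {z | x ≤ ‖(Φ.flow s z l).2‖ ^ 2} ≤ ∑ _l : Fin N, (1 : ℝ≥0∞) :=
        Finset.sum_le_sum fun l _ => prob_le_one
    _ = N := by simp

/-- **Markov at `s = 0`**: if `P` is carried by the good set (where `Φ_0 = id`) and the tail energy of
the data satisfies `E_P Σ_l ‖v_l‖² 𝟙{x ≤ ‖v_l‖²} ≤ b`, then the expected level count at time `0` and
level `x > 0` is at most `b / x`. -/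
theorem lintegral_levelCount_zero_le (Φ : HardSphereFlow (Torus.geometry (Fin 3)) ε N)
    (P : Measure (Config N (Fin 3) T3)) (hgood : ∀ᵐ z ∂P, z ∈ Φ.good) {x b : ℝ} (hx : 0 < x)
    (hdata : ∫⁻ z, ENNReal.ofReal (∑ l : Fin N,
        Set.indicator {v : V3 | x ≤ ‖v‖ ^ 2} (fun v => ‖v‖ ^ 2) ((z l).2)) ∂P ≤ ENNReal.ofReal b) :
    ∫⁻ z, (∑ l : Fin N, Set.indicator {v : V3 | x ≤ ‖v‖ ^ 2} (fun _ => (1 : ℝ≥0∞))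
        ((Φ.flow 0 z l).2)) ∂P ≤ ENNReal.ofReal (b / x) := by
  -- pointwise: `𝟙{x ≤ ‖v‖²} ≤ x⁻¹ ‖v‖² 𝟙{x ≤ ‖v‖²}`
  have hpt : ∀ v : V3, Set.indicator {v : V3 | x ≤ ‖v‖ ^ 2} (fun _ => (1 : ℝ≥0∞)) v
      ≤ ENNReal.ofReal (x⁻¹ * Set.indicator {v : V3 | x ≤ ‖v‖ ^ 2} (fun v => ‖v‖ ^ 2) v) := by
    intro v
    by_cases h : x ≤ ‖v‖ ^ 2
    · rw [Set.indicator_of_mem (show v ∈ {v : V3 | x ≤ ‖v‖ ^ 2} from h),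
        Set.indicator_of_mem (show v ∈ {v : V3 | x ≤ ‖v‖ ^ 2} from h)]
      rw [← ENNReal.ofReal_one]
      refine ENNReal.ofReal_le_ofReal ?_
      rw [← div_eq_inv_mul, le_div_iff₀ hx, one_mul]
      exact h
    · rw [Set.indicator_of_notMem (show v ∉ {v : V3 | x ≤ ‖v‖ ^ 2} from h)]
      exact bot_le
  have hae : ∀ᵐ z ∂P, (∑ l : Fin N, Set.indicator {v : V3 | x ≤ ‖v‖ ^ 2} (fun _ => (1 : ℝ≥0∞))
        ((Φ.flow 0 z l).2))
      ≤ ENNReal.ofReal x⁻¹ * ENNReal.ofReal (∑ l : Fin N,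
          Set.indicator {v : V3 | x ≤ ‖v‖ ^ 2} (fun v => ‖v‖ ^ 2) ((z l).2)) := by
    filter_upwards [hgood] with z hz
    rw [Φ.flow_zero z hz, ← ENNReal.ofReal_mul (inv_nonneg.2 hx.le), Finset.mul_sum,
      ENNReal.ofReal_sum_of_nonneg fun l _ => mul_nonneg (inv_nonneg.2 hx.le)
        (Set.indicator_nonneg (fun v _ => by positivity) _)]
    exact Finset.sum_le_sum fun l _ => hpt _
  calc ∫⁻ z, (∑ l : Fin N, Set.indicator {v : V3 | x ≤ ‖v‖ ^ 2} (fun _ => (1 : ℝ≥0∞))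
          ((Φ.flow 0 z l).2)) ∂P
      ≤ ∫⁻ z, ENNReal.ofReal x⁻¹ * ENNReal.ofReal (∑ l : Fin N,
          Set.indicator {v : V3 | x ≤ ‖v‖ ^ 2} (fun v => ‖v‖ ^ 2) ((z l).2)) ∂P := lintegral_mono_ae hae
    _ = ENNReal.ofReal x⁻¹ * ∫⁻ z, ENNReal.ofReal (∑ l : Fin N,
          Set.indicator {v : V3 | x ≤ ‖v‖ ^ 2} (fun v => ‖v‖ ^ 2) ((z l).2)) ∂P :=
        lintegral_const_mul' _ _ ENNReal.ofReal_ne_top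
    _ ≤ ENNReal.ofReal x⁻¹ * ENNReal.ofReal b := by gcongr
    _ = ENNReal.ofReal (b / x) := by
        rw [← ENNReal.ofReal_mul (inv_nonneg.2 hx.le), div_eq_inv_mul]

/-- **Being in contact at time `s` is a null event**: for a law `P ≪` Liouville, a flow of spheres of
diameter `ε ≠ 0` on the torus and a particle `i`, `P {z | i participates in a collision in Φ_s z} = 0`
(the event lies in `Φ_s⁻¹ (⋃_{a≠b} contactSet a b)`, contact sets are Liouville-null and `Φ_s`
preserves the Liouville measure). -/
theorem measure_participates_flow_eq_zero {d : Type*} [Fintype d] {n : ℕ} {ε : ℝ} (hε : ε ≠ 0)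
    (Φ : HardSphereFlow (Torus.geometry d) ε n) (P : Measure (Config n d (UnitAddTorus d)))
    (hP : P ≪ liouville (Torus.geometry d) n ε) (s : ℝ) (i : Fin n) :
    P {z | Participates (Torus.geometry d) ε (Φ.flow s z) i} = 0 := by
  set U : Set (Config n d (UnitAddTorus d)) :=
    ⋃ a : Fin n, ⋃ b : Fin n, ⋃ (_ : a ≠ b), contactSet (Torus.geometry d) n ε a b with hU
  have hUm : MeasurableSet U := by
    refine MeasurableSet.iUnion fun a => MeasurableSet.iUnion fun b => MeasurableSet.iUnion fun _ => ?_
    exact measurableSet_contactSet _ Torus.measurable_geometry_sepVec _ _ _ _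
  have hU0 : volume U = 0 := by
    refine (measure_iUnion_null_iff.2 fun a => measure_iUnion_null_iff.2 fun b =>
      measure_iUnion_null_iff.2 fun hab => ?_)
    exact volume_contactSet hε hab
  have hL0 : liouville (Torus.geometry d) n ε U = 0 :=
    le_antisymm ((Measure.restrict_le_self _).trans_eq hU0) bot_le
  have hpre : liouville (Torus.geometry d) n ε (Φ.flow s ⁻¹' U) = 0 := by
    rw [(Φ.measurePreserving s).measure_preimage hUm.nullMeasurableSet, hL0]
  refine measure_mono_null (fun z hz => ?_) (hP hpre)
  obtain ⟨j, hj | hj⟩ := hz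
  · have h := mem_contactPairs.1 hj
    exact Set.mem_preimage.2 (Set.mem_iUnion.2 ⟨i, Set.mem_iUnion.2 ⟨j, Set.mem_iUnion.2 ⟨h.1, h.2⟩⟩⟩)
  · have h := mem_contactPairs.1 hj
    exact Set.mem_preimage.2 (Set.mem_iUnion.2 ⟨j, Set.mem_iUnion.2 ⟨i, Set.mem_iUnion.2 ⟨h.1, h.2⟩⟩⟩)

/-- **Union bound of the census assembly** (abstract).  Events `A i` (levels), `R i`, `Λ i`, `I i`
(priced channels), `Col i` (null), a conull set `G` and an event `D`: if off `Gᶜ ∪ Col i` the level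
event is covered by `R i ∪ Λ i ∪ I i ∪ D`, the channels `R, Λ, D` are priced uniformly by `bR, bΛ, bD`
and the inheritance channel in sum by `bI`, then `Σ_i P(A i) ≤ n (bR + bΛ + bD) + bI`. -/
theorem sum_measure_le_of_cover : ∀ {α : Type*} [MeasurableSpace α] (P : Measure α) {n : ℕ}
    (A R Λ I Col : Fin n → Set α) (G D : Set α) {bR bΛ bD bI : ℝ}, 0 ≤ bR → 0 ≤ bΛ → 0 ≤ bD →
    0 ≤ bI → P Gᶜ = 0 → (∀ i, P (Col i) = 0) →
    (∀ i, ∀ z ∈ G, z ∉ Col i → z ∈ A i → z ∈ R i ∨ z ∈ Λ i ∨ z ∈ I i ∨ z ∈ D) →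
    (∀ i, P (R i) ≤ ENNReal.ofReal bR) → (∀ i, P (Λ i) ≤ ENNReal.ofReal bΛ) →
    P D ≤ ENNReal.ofReal bD → (∑ i, P (I i ∩ G)) ≤ ENNReal.ofReal bI →
    (∑ i, P (A i)) ≤ ENNReal.ofReal (n * (bR + bΛ + bD) + bI) := by
  intro α _ P n A R Λ I Col G D bR bΛ bD bI hbR hbΛ hbD hbI hG hCol hcover hR hΛ hD hI
  have hsub : ∀ i, A i ⊆ (Gᶜ ∪ Col i) ∪ ((R i ∪ Λ i ∪ D) ∪ (I i ∩ G)) := by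
    intro i z hz
    by_cases hzG : z ∈ G
    · by_cases hzC : z ∈ Col i
      · exact Or.inl (Or.inr hzC)
      · rcases hcover i z hzG hzC hz with h | h | h | h
        · exact Or.inr (Or.inl (Or.inl (Or.inl h)))
        · exact Or.inr (Or.inl (Or.inl (Or.inr h)))
        · exact Or.inr (Or.inr ⟨h, hzG⟩)
        · exact Or.inr (Or.inl (Or.inr h))
    · exact Or.inl (Or.inl hzG)
  have hAi : ∀ i, P (A i) ≤ (ENNReal.ofReal bR + ENNReal.ofReal bΛ + ENNReal.ofReal bD) + P (I i ∩ G) := by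
    intro i
    calc P (A i) ≤ P ((Gᶜ ∪ Col i) ∪ ((R i ∪ Λ i ∪ D) ∪ (I i ∩ G))) := measure_mono (hsub i)
      _ ≤ P (Gᶜ ∪ Col i) + P ((R i ∪ Λ i ∪ D) ∪ (I i ∩ G)) := measure_union_le _ _
      _ ≤ (P Gᶜ + P (Col i)) + ((P (R i ∪ Λ i) + P D) + P (I i ∩ G)) := by
          gcongr
          · exact measure_union_le _ _
          · exact (measure_union_le _ _).trans (add_le_add (measure_union_le _ _) le_rfl)
      _ ≤ (0 + 0) + ((ENNReal.ofReal bR + ENNReal.ofReal bΛ + ENNReal.ofReal bD) + P (I i ∩ G)) := by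
          rw [hG, hCol i]
          gcongr ?_ + (?_ + _)
          · exact le_rfl
          · exact add_le_add ((measure_union_le _ _).trans (add_le_add (hR i) (hΛ i))) hD
      _ = _ := by rw [zero_add, zero_add]
  calc (∑ i, P (A i))
      ≤ ∑ i, ((ENNReal.ofReal bR + ENNReal.ofReal bΛ + ENNReal.ofReal bD) + P (I i ∩ G)) :=
        Finset.sum_le_sum fun i _ => hAi i
    _ = n * (ENNReal.ofReal bR + ENNReal.ofReal bΛ + ENNReal.ofReal bD) + ∑ i, P (I i ∩ G) := by
        rw [Finset.sum_add_distrib, Finset.sum_const, Finset.card_univ, Fintype.card_fin, nsmul_eq_mul]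
    _ ≤ n * (ENNReal.ofReal bR + ENNReal.ofReal bΛ + ENNReal.ofReal bD) + ENNReal.ofReal bI := by
        gcongr
    _ = ENNReal.ofReal (n * (bR + bΛ + bD) + bI) := by
        rw [ENNReal.ofReal_add (by positivity) hbI, ENNReal.ofReal_mul (Nat.cast_nonneg n),
          ENNReal.ofReal_natCast, ENNReal.ofReal_add (by positivity) hbD,
          ENNReal.ofReal_add hbR hbΛ]

end Summit.AtomisticToContinuum.HydrodynamicLimit.Theorems.EnergyCurrentTailsPedigree

end
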